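import Literature.Probability.Percolation.ArmExponentsTwoArm
import Literature.Probability.Percolation.NearCriticalFourArmFacts
import Mathlib.Analysis.SpecialFunctions.Pow.Asymptotics
import HarnessLib

/-!
# The four-arm exponent `5/4`: Smirnov–Werner's assembly, proved; positivity of `π₄`

Family: crit-perc (trunk StatMech). This file serves the named fact
`Literature.Probability.Percolation.fourArm_exponent` (`ArmExponents.lean`; Smirnov–Werner,
*Critical exponents for two-dimensional percolation*, Math. Res. Lett. 8 (2001), 729–744, Thm. 4
of the arXiv text `math/0109120` ("Plane exponents"), `j = 4`: for critical site percolation on `𝕋`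
and every large enough `r₀`, `P_{1/2}(armEvent ![T,F,T,F] r₀ R) = R^{-5/4 + o(1)}`; equation
numbers below are those of the arXiv text).

Smirnov–Werner (§4, p. 7: "Exactly as its half-plane counterpart, the theorem follows from the two
observations which will be discussed below") reduce Thm. 4 to

* **(A) the scaling limit and its `SLE₆` exponent**: (16) `b'_j(R/r) = lim_ρ b_j(ρ r, ρ R)` exists
  (Smirnov's theorem) and (9) it decays like `(R/r)^{-(j²-1)/12 + o(1)}` ((12): convergence of the
  exploration process in the universal cover of the annulus to `SLE₆`, using the a priori six-arm
  bound (11); (13)–(14): the radial/chordal `SLE₆` exponents of Lawler–Schramm–Werner; (15) and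
  the sentence after it: `b_j^{ep} ≍ b_j` for even `j`). For `j = 4`, `(j² - 1)/12 = 5/4`.
* **(B) approximate multiplicativity** (10) (§4.2; Kesten 1987; in Werner's lectures, Lecture 6,
  Cor. 6.2: `c · π̂(r₁, r₂) · π̂(4 r₂, r₃) ≤ π̂(r₁, r₃)` for `16 r₁ < 4 r₂ < r₃`), which the tree
  records as the named fact `Werner2009_fourArm_quasiMult` (`NearCriticalFourArmFacts.lean`,
  usable at `t = 1/2` where the restriction `≤ L(p)` is void),

and the elementary inputs **(C)** sub-multiplicativity `polyArmProb_submult`, **(D)** monotonicity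
in the outer radius `polyArmProb_anti_holds` (both PROVED in `ArmEventsProofs.lean`) and **(E)**
positivity of the four-arm probability, PROVED here (`critFourArmProb_pos`: four axis rays of
prescribed colours form a cylinder event; Nolin 2008, §4.1, `n₀(j)`).

This file PROVES the assembly — the product-of-scales argument printed by Smirnov–Werner on p. 5
(proof of Thm. 3 from (3)–(4): choose a large ratio `K`, chain the annuli between consecutive
powers of `K`, sandwich `K^n ≤ N < K^{n+1}`) and, for `π₄` itself, by Werner (*Lectures on
two-dimensional critical percolation*, PCMI 2009, Lecture 5, Thm. 5.2 "`π₄(0, n) = n^{-5/4+o(1)}`",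
"End of the proof") — once and for all for an ABSTRACT two-radius sequence `b : ℕ → ℕ → ℝ`
(namespace `ArmExponentAssembly`: hypotheses (A)–(E) in, decay exponent `α` out). There the
quasi-multiplicativity (B) is taken in Werner's gapped form `c · b(r, R) · b(4R, S) ≤ b(r, S)`, so
both chains run along the annuli `Λ_{K^{m+1}} ∖ Λ_{4K^m}`, and (A) is taken in the weakest form the
argument uses, the two-sided SCALE BOUNDS: for every `ε > 0`, for all large ratios `K` and then
all large scales `σ`, `K^{-α-ε} ≤ b(4σ, Kσ) ≤ K^{-α+ε}` (`hasDecayExponent_of_scales`). Both printed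
forms of (A) imply the scale bounds (proved: `scaleBounds_of_ratioLimit` for SW's
"`lim_ρ b(ρ r, ρ R) = b'(R/r)`, `b'(λ) = λ^{-α+o(1)}`", and `scaleBounds_of_asympBounds` for
Werner's "`lim_n π̂₄(rn, n) ≍ r^{5/4}`" up-to-constants form, Lecture 5, §3). The specialisations
`fourArm_exponent_of_scaleBounds`, `fourArm_exponent_of_scalingLimit`,
`fourArm_exponent_of_asympBounds : (A for j = 4) → Werner2009_fourArm_quasiMult → fourArm_exponent`
spell hypothesis (A) out in the theorem (the middle one in the shape of the two-arm named fact
`SmirnovWerner2001_twoArm_scalingLimit` of `ArmExponentsTwoArm.lean`); (A) is Smirnov's theorem plus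
the `SLE₆` exponent computations, a theory absent from the tree, and is NOT recorded as a named
fact here (D-0026). What remains for an unconditional `fourArm_exponent_holds` is exactly (A) and
the discharge of `Werner2009_fourArm_quasiMult`.

Faithfulness notes.
* Shapes: SW use discretised circular annuli ("One could as well take a semi-hexagonal or a
  triangular shape", p. 5); the tree's `armEvent` uses the lattice hexagons `Λ_R ∖ Λ_r`; nested
  within constant factors of the radii, invisible in `o(1)` exponents.
* Colours: `armEvent ![T,F,T,F]` prescribes two open and two closed arms without the cyclic order,
  i.e. the union of the alternating and the adjacent pattern; both are polychromatic four-arm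
  events, of exponent `5/4` (SW, paragraph before Thm. 4: "exponents are the same for `j` crossings
  of any prescribed colours in any prescribed order, as long as colours are not all the same").
* Numbering: SW's theorem/equation numbers are those of arXiv `math/0109120` (Thm. 4 = plane
  exponents; the docstring of `fourArm_exponent` calls it "Thm. 1"); Werner's are those of
  arXiv 0710.0856 = the PCMI volume (Lecture 5, Thm. 5.2, Lemmas 5.1–5.2; Lecture 6, Cor. 6.2);
  Nolin's §4.1 is that of arXiv 0711.4948.

Mathlib search: no percolation / arm events / `SLE` in Mathlib; `Nat.log`, `Real.log`, `Real.rpow`,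
`tendsto_rpow_atTop`, `Filter.Tendsto`, `Pi.single` API from Mathlib. Tree reuse: the elementary
real-analysis helpers `TwoArmAssembly.tendsto_affine_div_affine`,
`TwoArmAssembly.div_le_div_of_nonpos_left'` and the cylinder-event positivity
`TwoArmPos.triSitePercolation_half_cylinder_pos` of the two-arm files are imported, not re-proved.
This file introduces no named fact and no definition of a mathematical object (only the auxiliary
ray sites/walks `FourArmPos.rayPt`, `FourArmPos.rayWalk`, `FourArmPos.dir`, `FourArmPos.sgn` of the
positivity proof).
-/

noncomputable section

open Filter Topology MeasureTheory
open scoped ENNReal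

namespace Literature.Probability.Percolation

open LatticeModels

/-! ### (E) Positivity of the four-arm probability: four axis rays and a cylinder event -/

namespace FourArmPos

/-- The site `t · e_i` of `ℤ² = V(𝕋)` (`e₀ = (1, 0)`, `e₁ = (0, 1)`). [folklore] -/
def rayPt (i : Fin 2) (t : ℤ) : Site 2 := Pi.single i t

/-- The `i`-th coordinate of `rayPt i t` is `t`. [folklore] -/
@[simp] theorem rayPt_apply_self (i : Fin 2) (t : ℤ) : rayPt i t i = t := by simp [rayPt]

/-- The other coordinate of `rayPt i t` vanishes. [folklore] -/
theorem rayPt_apply_of_ne {i j : Fin 2} (h : j ≠ i) (t : ℤ) : rayPt i t j = 0 := by simp [rayPt, h]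

/-- The graph norm of `rayPt i t` is `|t|`. [folklore] -/
theorem triNorm_rayPt (i : Fin 2) (t : ℤ) : triNorm (rayPt i t) = |t| := by
  fin_cases i <;> simp [rayPt, triNorm]

/-- Two ray sites coincide only trivially: if `rayPt i a = rayPt i' a'` with `a ≠ 0` then `i = i'`
and `a = a'`. [folklore] -/
theorem rayPt_inj {i i' : Fin 2} {a a' : ℤ} (h : rayPt i a = rayPt i' a') (ha : a ≠ 0) :
    i = i' ∧ a = a' := by
  by_cases hii : i = i'
  · subst hii
    have := congrFun h i
    simp only [rayPt_apply_self] at this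
    exact ⟨rfl, this⟩
  · have := congrFun h i
    rw [rayPt_apply_self, rayPt_apply_of_ne hii] at this
    exact absurd this ha

/-- One step along the `i`-th axis. [folklore] -/
theorem rayPt_add_one (i : Fin 2) (t : ℤ) : rayPt i (t + 1) = rayPt i t + Pi.single i 1 := by
  simp [rayPt, Pi.single_add]

/-- Consecutive sites of an axis are adjacent in `𝕋` (already in `ℤ²`). [folklore] -/
theorem triGraph_adj_rayPt (i : Fin 2) (t ε : ℤ) (hε : ε = 1 ∨ ε = -1) :
    triGraph.Adj (rayPt i t) (rayPt i (t + ε)) := by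
  apply zdGraph_le_triGraph
  rw [zdGraph_adj_iff]
  rcases hε with rfl | rfl
  · exact ⟨i, Or.inl (rayPt_add_one i t)⟩
  · refine ⟨i, Or.inr ?_⟩
    rw [← rayPt_add_one]
    congr 1
    ring

/-- The straight walk `t e_i, (t+ε) e_i, …, (t+nε) e_i` of `𝕋` along the `i`-th axis. [folklore] -/
def rayWalk (i : Fin 2) (ε : ℤ) (hε : ε = 1 ∨ ε = -1) (t : ℤ) :
    (n : ℕ) → triGraph.Walk (rayPt i t) (rayPt i (t + n * ε))
  | 0 => (SimpleGraph.Walk.nil : triGraph.Walk (rayPt i t) (rayPt i t)).copy rfl (by simp)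
  | n + 1 => ((rayWalk i ε hε t n).concat (triGraph_adj_rayPt i (t + n * ε) ε hε)).copy rfl
      (by congr 1; push_cast; ring)

/-- The vertices of the straight walk. [folklore] -/
theorem support_rayWalk (i : Fin 2) (ε : ℤ) (hε : ε = 1 ∨ ε = -1) (t : ℤ) (n : ℕ) :
    (rayWalk i ε hε t n).support = (List.range (n + 1)).map fun k : ℕ => rayPt i (t + k * ε) := by
  induction n with
  | zero => simp [rayWalk]
  | succ n ih =>
    rw [rayWalk, SimpleGraph.Walk.support_copy, SimpleGraph.Walk.support_concat, ih]
    conv_rhs => rw [List.range_succ, List.map_append, List.map_singleton]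
    rw [show t + (n : ℤ) * ε + ε = t + ((n + 1 : ℕ) : ℤ) * ε by push_cast; ring]

/-- Membership in the straight walk. [folklore] -/
theorem mem_support_rayWalk {i : Fin 2} {ε : ℤ} {hε : ε = 1 ∨ ε = -1} {t : ℤ} {n : ℕ} {v : Site 2} :
    v ∈ (rayWalk i ε hε t n).support ↔ ∃ k : ℕ, k ≤ n ∧ v = rayPt i (t + k * ε) := by
  rw [support_rayWalk]
  simp only [List.mem_map, List.mem_range]
  constructor
  · rintro ⟨k, hk, rfl⟩
    exact ⟨k, by omega, rfl⟩
  · rintro ⟨k, hk, rfl⟩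
    exact ⟨k, by omega, rfl⟩

/-- The straight walk is self-avoiding. [folklore] -/
theorem isPath_rayWalk (i : Fin 2) (ε : ℤ) (hε : ε = 1 ∨ ε = -1) (t : ℤ) (n : ℕ) :
    (rayWalk i ε hε t n).IsPath := by
  rw [SimpleGraph.Walk.isPath_def, support_rayWalk]
  refine (List.nodup_range).map fun k l hkl => ?_
  have h := congrFun (hkl : rayPt _ _ = rayPt _ _) i
  simp only [rayPt_apply_self] at h
  rcases hε with rfl | rfl
  · have : (k : ℤ) = l := by linarith
    exact_mod_cast this
  · have : (k : ℤ) = l := by linarith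
    exact_mod_cast this

/-- Axis of the `j`-th ray of the four-arm configuration: `e₀, e₁, e₀, e₁`. [folklore] -/
def dir : Fin 4 → Fin 2 := ![0, 1, 0, 1]

/-- Orientation of the `j`-th ray of the four-arm configuration: `+, +, -, -`. [folklore] -/
def sgn : Fin 4 → ℤ := ![1, 1, -1, -1]

/-- Each orientation is `±1`. [folklore] -/
theorem sgn_eq (j : Fin 4) : sgn j = 1 ∨ sgn j = -1 := by
  fin_cases j <;> simp [sgn]

/-- `|sgn j| = 1`. [folklore] -/
theorem abs_sgn (j : Fin 4) : |sgn j| = 1 := by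
  rcases sgn_eq j with h | h <;> simp [h]

/-- The four rays `+e₀, +e₁, -e₀, -e₁` are distinct: `(dir, sgn)` is injective. [folklore] -/
theorem eq_of_dir_eq_of_sgn_eq {j j' : Fin 4} (hd : dir j = dir j') (hs : sgn j = sgn j') : j = j' := by
  fin_cases j <;> fin_cases j' <;> simp_all [dir, sgn]

/-- The graph norm of the `k`-th site of the `j`-th ray started at radius `r` is `r + k`. [folklore] -/
theorem triNorm_ray (j : Fin 4) (r k : ℕ) : triNorm (rayPt (dir j) (sgn j * ((r : ℤ) + k))) = r + k := by
  rw [triNorm_rayPt, abs_mul, abs_sgn, one_mul]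
  exact abs_of_nonneg (by positivity)

end FourArmPos

open FourArmPos in
/-- **Positivity of the four-arm probability.** For `1 ≤ r ≤ R` the four-arm event
`armEvent ![true, false, true, false] r R` has positive `P_{1/2}`-probability: the rays
`{t e₀}`, `{t e₁}`, `{-t e₀}`, `{-t e₁}`, `r ≤ t ≤ R`, are pairwise disjoint arms across
`Λ_R ∖ Λ_r`, and prescribing their sites open/closed/open/closed is a cylinder event of positive
probability. (For `r = 0` the event is empty, whence "for all large enough `r`" in Smirnov–Werner's
Thm. 4.) (Nolin 2008, §4.1, definition of `n₀(j)`: "we can then draw straight lines heading toward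
the exterior", `A_{j,σ}(n₀(j), N) ≠ ∅`; here `j = 4 ≤ 6` rays along lattice axes suffice.) [cite: Nolin2008, §4.1 (n₀(j))] -/
theorem critFourArmProb_pos {r R : ℕ} (hr : 1 ≤ r) (hrR : r ≤ R) : 0 < critFourArmProb r R := by
  classical
  obtain ⟨n, rfl⟩ : ∃ n : ℕ, R = r + n := ⟨R - r, by omega⟩
  set κ : Fin 4 → Bool := ![true, false, true, false] with hκ
  -- the four rays, uniformly in `j`
  set W : ∀ j : Fin 4, triGraph.Walk (rayPt (dir j) (sgn j * r)) (rayPt (dir j) (sgn j * r + n * sgn j)) :=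
    fun j => rayWalk (dir j) (sgn j) (sgn_eq j) (sgn j * r) n with hW
  -- sites of the rays
  have hmemW : ∀ j, ∀ v ∈ (W j).support, ∃ k : ℕ, k ≤ n ∧ v = rayPt (dir j) (sgn j * ((r : ℤ) + k)) := by
    intro j v hv
    obtain ⟨k, hk, rfl⟩ := mem_support_rayWalk.1 hv
    exact ⟨k, hk, by congr 1; ring⟩
  -- two rays meet only if they are the same ray
  have hdisj : ∀ j j', ∀ v, v ∈ (W j).support → v ∈ (W j').support → j = j' := by
    intro j j' v hv hv'
    obtain ⟨k, -, rfl⟩ := hmemW j v hv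
    obtain ⟨k', -, hkk'⟩ := hmemW j' _ hv'
    have hr1 : (1 : ℤ) ≤ r := by exact_mod_cast hr
    have hne : sgn j * ((r : ℤ) + k) ≠ 0 := by
      rcases sgn_eq j with h | h <;> · rw [h]; intro h0; nlinarith
    obtain ⟨hd, hs⟩ := rayPt_inj hkk' hne
    rcases sgn_eq j with h | h <;> rcases sgn_eq j' with h' | h'
    · exact eq_of_dir_eq_of_sgn_eq hd (h.trans h'.symm)
    · exfalso; rw [h, h'] at hs; nlinarith
    · exfalso; rw [h, h'] at hs; nlinarith
    · exact eq_of_dir_eq_of_sgn_eq hd (h.trans h'.symm)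
  -- the cylinder event: the sites of the rays, coloured by `κ`
  set S : Finset (Site 2) := Finset.univ.biUnion fun j => (W j).support.toFinset with hS
  set b : Site 2 → Prop := fun v => ∃ j, κ j = true ∧ v ∈ (W j).support with hb
  have hcyl : {ω : SiteConfig (Site 2) | ∀ v ∈ S, (v ∈ ω ↔ b v)} ⊆ armEvent κ r (r + n) := by
    intro ω hω
    simp only [Set.mem_setOf_eq] at hω
    refine ⟨fun j => rayPt (dir j) (sgn j * r), fun j => rayPt (dir j) (sgn j * r + n * sgn j), W,
      fun j => ⟨?_, ?_, isPath_rayWalk _ _ _ _ _, fun v hv => ?_, fun v hv => ?_⟩, ?_⟩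
    · rw [mem_triSphere_iff]
      have := triNorm_ray j r 0
      simpa using this
    · rw [mem_triSphere_iff]
      have := triNorm_ray j r n
      rw [show sgn j * ((r : ℤ) + n) = sgn j * r + n * sgn j by ring] at this
      rw [this]
      push_cast
      ring
    · obtain ⟨k, hk, rfl⟩ := hmemW j v hv
      rcases Nat.eq_zero_or_pos k with rfl | hk0
      · right
        rw [mem_triSphere_iff, triNorm_ray]
        simp
      · left
        simp only [Set.mem_sdiff, Finset.mem_coe, mem_triBall_iff, triNorm_ray, not_le]
        constructor
        · push_cast; linarith
        · exact_mod_cast Nat.lt_add_of_pos_right hk0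
    · have hvS : v ∈ S := by
        rw [hS, Finset.mem_biUnion]
        exact ⟨j, Finset.mem_univ _, List.mem_toFinset.2 hv⟩
      rw [hω v hvS]
      constructor
      · rintro ⟨j', hκj', hv'⟩
        rw [← hdisj j' j v hv' hv]
        exact hκj'
      · intro hκj
        exact ⟨j, hκj, hv⟩
    · intro i j hij
      exact Finset.disjoint_left.2 fun v hvi hvj =>
        hij (hdisj i j v (List.mem_toFinset.1 hvi) (List.mem_toFinset.1 hvj))
  calc (0 : ℝ) < (triSitePercolation half).real {ω : SiteConfig (Site 2) | ∀ v ∈ S, (v ∈ ω ↔ b v)} :=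
        TwoArmPos.triSitePercolation_half_cylinder_pos S b
    _ ≤ critFourArmProb r (r + n) := by
        unfold critFourArmProb polyArmProb
        exact measureReal_mono hcyl

/-! ### The product-of-scales assembly for an abstract two-radius sequence

Smirnov–Werner 2001, p. 5 (proof of Thm. 3 from (3)–(4)) and Werner 2009, Lecture 5, "End of the
proof" of Thm. 5.2, run with the gapped quasi-multiplicativity of Werner 2009, Lecture 6, Cor. 6.2.
Throughout, `b r R` plays the role of an arm probability of the annulus `Λ_R ∖ Λ_r`, and the
scale bounds `K^{-α∓ε} ≶ b(4σ, Kσ)` play the role of the scaling limit with its `SLE₆` exponent. -/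

namespace ArmExponentAssembly

open TwoArmAssembly (div_le_div_of_nonpos_left' tendsto_affine_div_affine)

/-- `4 m < K ^ m` for `K ≥ 5`. [folklore] -/
theorem four_mul_lt_pow {K : ℕ} (hK : 5 ≤ K) (m : ℕ) : 4 * m < K ^ m := by
  induction m with
  | zero => simp
  | succ m ih =>
    have h1 : 1 ≤ K ^ m := Nat.one_le_pow _ _ (by omega)
    calc 4 * (m + 1) = 4 * m + 4 := by ring
      _ < K ^ m + 4 * K ^ m := by omega
      _ = 5 * K ^ m := by ring
      _ ≤ K * K ^ m := Nat.mul_le_mul_right _ hK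
      _ = K ^ (m + 1) := by rw [pow_succ, mul_comm]

/-- `4 K^m ≤ K^{m+1}` for `K ≥ 4`, in the form `4 K^m ≤ K^n` for `m < n`. [folklore] -/
theorem four_mul_pow_le_pow {K m n : ℕ} (hK : 4 ≤ K) (hmn : m < n) : 4 * K ^ m ≤ K ^ n := by
  calc 4 * K ^ m ≤ K * K ^ m := Nat.mul_le_mul_right _ hK
    _ = K ^ (m + 1) := by rw [pow_succ, mul_comm]
    _ ≤ K ^ n := Nat.pow_le_pow_right (by omega) hmn

/-- The upper chain: if `b(4K^m, K^{m+1}) ≤ U` for all `m ≥ j₀`, then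
`b(4K^m, K^{m+1+d}) ≤ U^{d+1}` (sub-multiplicativity (C) and monotonicity (D) along the scales
`K^m`; Smirnov–Werner 2001, p. 5 and §4.2, proof of (10), left half). [cite: SmirnovWernerMRL2001, §4.2 proof of (10)] -/
theorem upper_chain (b : ℕ → ℕ → ℝ) (hb0 : ∀ r R, 0 ≤ b r R)
    (hanti : ∀ ⦃r R R' : ℕ⦄, r ≤ R → R ≤ R' → b r R' ≤ b r R)
    (hsub : ∀ ⦃n₁ n₂ n₃ : ℕ⦄, n₁ ≤ n₂ → n₂ < n₃ → b n₁ n₃ ≤ b n₁ n₂ * b (n₂ + 1) n₃)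
    {K j₀ : ℕ} (hK : 4 ≤ K)
    {U : ℝ} (hU0 : 0 ≤ U) (hU : ∀ m, j₀ ≤ m → b (4 * K ^ m) (K ^ (m + 1)) ≤ U) :
    ∀ d m n : ℕ, j₀ ≤ m → n = m + 1 + d → b (4 * K ^ m) (K ^ n) ≤ U ^ (d + 1) := by
  intro d
  induction d with
  | zero =>
    intro m n hm hn
    subst hn
    simpa using hU m hm
  | succ d ih =>
    intro m n hm hn
    subst hn
    have hKpos : 0 < K ^ (m + 1) := pow_pos (by omega) _
    obtain ⟨n₂, hn₂⟩ : ∃ n₂, n₂ + 1 = 4 * K ^ (m + 1) := ⟨4 * K ^ (m + 1) - 1, by omega⟩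
    have h12 : 4 * K ^ m ≤ n₂ := by
      have := four_mul_pow_le_pow hK (show m < m + 1 by omega)
      omega
    have h23 : n₂ < K ^ (m + 1 + (d + 1)) := by
      have := four_mul_pow_le_pow hK (show m + 1 < m + 1 + (d + 1) by omega)
      omega
    have step := hsub h12 h23
    rw [hn₂] at step
    have hmono : b (4 * K ^ m) n₂ ≤ b (4 * K ^ m) (K ^ (m + 1)) :=
      hanti (four_mul_pow_le_pow hK (show m < m + 1 by omega)) (by omega)
    have ih' := ih (m + 1) (m + 1 + (d + 1)) (by omega) (by ring)
    calc b (4 * K ^ m) (K ^ (m + 1 + (d + 1)))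
        ≤ b (4 * K ^ m) n₂ * b (4 * K ^ (m + 1)) (K ^ (m + 1 + (d + 1))) := step
      _ ≤ U * U ^ (d + 1) := mul_le_mul (hmono.trans (hU m hm)) ih' (hb0 _ _) hU0
      _ = U ^ (d + 1 + 1) := by ring

/-- The lower chain: if `L ≤ b(4K^m, K^{m+1})` for all `m ≥ j₀` (and `K > 16`), then
`c^d L^{d+1} ≤ b(4K^m, K^{m+1+d})` (gapped quasi-multiplicativity (B) along the scales `K^m`;
Smirnov–Werner 2001, p. 5, and (10), right half; Werner 2009, Lecture 6, Cor. 6.2). [cite: SmirnovWernerMRL2001, §3 proof of Thm. 3 (p. 5) and §4 (10)] [cite: WernerPCMI2009, Lecture 6, Cor. 6.2] -/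
theorem lower_chain (b : ℕ → ℕ → ℝ) (hb0 : ∀ r R, 0 ≤ b r R) {c : ℝ} (hc : 0 ≤ c) {n₀ : ℕ}
    (hqm : ∀ ⦃r R S : ℕ⦄, n₀ ≤ r → 16 * r < 4 * R → 4 * R < S → c * (b r R * b (4 * R) S) ≤ b r S)
    {K j₀ : ℕ} (hK : 17 ≤ K) (hn₀ : ∀ m, j₀ ≤ m → n₀ ≤ 4 * K ^ m)
    {L : ℝ} (hL0 : 0 ≤ L) (hL : ∀ m, j₀ ≤ m → L ≤ b (4 * K ^ m) (K ^ (m + 1))) :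
    ∀ d m n : ℕ, j₀ ≤ m → n = m + 1 + d → c ^ d * L ^ (d + 1) ≤ b (4 * K ^ m) (K ^ n) := by
  intro d
  induction d with
  | zero =>
    intro m n hm hn
    subst hn
    simpa using hL m hm
  | succ d ih =>
    intro m n hm hn
    subst hn
    have hKpos : 0 < K ^ m := pow_pos (by omega) _
    have h12 : 16 * (4 * K ^ m) < 4 * K ^ (m + 1) := by
      have : 16 * K ^ m < K ^ (m + 1) := by
        calc 16 * K ^ m < K * K ^ m := Nat.mul_lt_mul_of_pos_right (by omega) hKpos
          _ = K ^ (m + 1) := by rw [pow_succ, mul_comm]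
      omega
    have h23 : 4 * K ^ (m + 1) < K ^ (m + 1 + (d + 1)) := by
      have hKpos' : 0 < K ^ (m + 1) := pow_pos (by omega) _
      calc 4 * K ^ (m + 1) < K * K ^ (m + 1) := Nat.mul_lt_mul_of_pos_right (by omega) hKpos'
        _ = K ^ (m + 1 + 1) := by ring
        _ ≤ K ^ (m + 1 + (d + 1)) := Nat.pow_le_pow_right (by omega) (by omega)
    have step := hqm (hn₀ m hm) h12 h23
    have ih' := ih (m + 1) (m + 1 + (d + 1)) (by omega) (by ring)
    calc c ^ (d + 1) * L ^ (d + 1 + 1) = c * (L * (c ^ d * L ^ (d + 1))) := by ring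
      _ ≤ c * (b (4 * K ^ m) (K ^ (m + 1)) * b (4 * K ^ (m + 1)) (K ^ (m + 1 + (d + 1)))) := by
          apply mul_le_mul_of_nonneg_left _ hc
          exact mul_le_mul (hL m hm) ih' (mul_nonneg (pow_nonneg hc _) (pow_nonneg hL0 _)) (hb0 _ _)
      _ ≤ b (4 * K ^ m) (K ^ (m + 1 + (d + 1))) := step

/-- Upper half of the exponent: from the upper scale bound of (A) (`b(4σ, Kσ) ≤ K^{-α+ε}` for
large `K` and then large `σ`), sub-multiplicativity (C), monotonicity (D) and positivity (E), for
every `a ∈ (-α, 0)` eventually `log b(r₀, N) / log N < a` (Smirnov–Werner 2001, p. 5, upper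
product bound; Werner 2009, Lecture 5, end of the proof of Thm. 5.2, first display; sandwich
`K^n ≤ N < K^{n+1}`). [cite: SmirnovWernerMRL2001, §3 proof of Thm. 3 (p. 5) and §4] [cite: WernerPCMI2009, Lecture 5, Thm. 5.2 (end of the proof)] -/
theorem upper_part (b : ℕ → ℕ → ℝ) (hb0 : ∀ r R, 0 ≤ b r R) (hb1 : ∀ r R, b r R ≤ 1)
    (hanti : ∀ ⦃r R R' : ℕ⦄, r ≤ R → R ≤ R' → b r R' ≤ b r R)
    (hsub : ∀ ⦃n₁ n₂ n₃ : ℕ⦄, n₁ ≤ n₂ → n₂ < n₃ → b n₁ n₃ ≤ b n₁ n₂ * b (n₂ + 1) n₃)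
    {r₁ : ℕ} (hpos : ∀ ⦃r R : ℕ⦄, r₁ ≤ r → r ≤ R → 0 < b r R) {α : ℝ}
    (hA : ∀ ε : ℝ, 0 < ε → ∀ᶠ K : ℕ in atTop, ∀ᶠ σ : ℕ in atTop, b (σ * 4) (σ * K) ≤ (K : ℝ) ^ (-α + ε))
    {r₀ : ℕ} (hr₀ : r₁ ≤ r₀) {a : ℝ} (ha : -α < a) (ha0 : a < 0) :
    ∀ᶠ N : ℕ in atTop, Real.log (b r₀ N) / Real.log N < a := by
  -- an intermediate exponent `-α < a' < a`
  set a' : ℝ := (a + -α) / 2 with ha'_def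
  have ha'1 : -α < a' := by rw [ha'_def]; linarith
  have ha'2 : a' < a := by rw [ha'_def]; linarith
  have ha'0 : a' < 0 := by linarith
  -- Step 1: the ratio `K` and the scale `σ₀` beyond which `b(4σ, Kσ) ≤ K^{a'}`
  have hA' := hA (a' + α) (by linarith)
  have hε : -α + (a' + α) = a' := by ring
  simp only [hε] at hA'
  obtain ⟨K, hKA, hK5⟩ := (hA'.and (eventually_ge_atTop 5)).exists
  obtain ⟨σ₀, hσ₀⟩ := eventually_atTop.1 hKA
  have hK4le : 4 ≤ K := by omega
  have hK1 : 1 < K := by omega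
  have hKR : (5 : ℝ) ≤ K := by exact_mod_cast hK5
  have hKpos : (0 : ℝ) < K := by linarith
  have hlogKpos : 0 < Real.log (K : ℝ) := Real.log_pos (by linarith)
  -- the per-scale bound `U = K^{a'}`
  set U : ℝ := (K : ℝ) ^ a' with hU_def
  have hU0 : 0 < U := Real.rpow_pos_of_pos hKpos _
  have hlogU : Real.log U = a' * Real.log K := Real.log_rpow hKpos _
  -- Step 2: the first scale `K^{j₀}`
  set j₀ : ℕ := max σ₀ r₀ with hj₀_def
  have hj₀σ : σ₀ ≤ j₀ := le_max_left _ _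
  have hj₀r : r₀ ≤ j₀ := le_max_right _ _
  have hpow_gt : ∀ m : ℕ, m < K ^ m := fun m => Nat.lt_pow_self hK1
  have hUm : ∀ m, j₀ ≤ m → b (4 * K ^ m) (K ^ (m + 1)) ≤ U := by
    intro m hm
    have hρ : σ₀ ≤ K ^ m := by have := hpow_gt m; omega
    have := hσ₀ (K ^ m) hρ
    rwa [mul_comm (K ^ m) 4, ← pow_succ] at this
  have hchain := upper_chain b hb0 hanti hsub hK4le hU0.le hUm
  -- Step 3: the affine ratio `a' (d + 1) / (d + j₀ + 2) → a' < a`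
  have h6 : ∀ᶠ d : ℕ in atTop, (a' * d + a') / (1 * d + ((j₀ : ℝ) + 2)) < a := by
    have h := tendsto_affine_div_affine a' a' 1 ((j₀ : ℝ) + 2) one_ne_zero
    rw [div_one] at h
    exact h.eventually_lt_const ha'2
  obtain ⟨d₀, hd₀⟩ := eventually_atTop.1 h6
  -- Step 4: sandwich `K^n ≤ N < K^{n+1}` and conclude
  filter_upwards [eventually_ge_atTop (K ^ (j₀ + 1 + d₀))] with N hN
  have hKpowpos : 0 < K ^ (j₀ + 1 + d₀) := pow_pos (by omega) _
  have hNpos : N ≠ 0 := by omega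
  set n := Nat.log K N with hn_def
  have hn_ge : j₀ + 1 + d₀ ≤ n := Nat.le_log_of_pow_le hK1 hN
  have hKn_le : K ^ n ≤ N := Nat.pow_log_le_self K hNpos
  have hN_lt : N < K ^ (n + 1) := Nat.lt_pow_succ_log_self hK1 N
  obtain ⟨d, hd⟩ : ∃ d, n = j₀ + 1 + d := ⟨n - (j₀ + 1), by omega⟩
  have hd₀d : d₀ ≤ d := by omega
  have hr₀Kn : r₀ ≤ K ^ n := by have := hpow_gt n; omega
  obtain ⟨n₂, hn₂⟩ : ∃ n₂, n₂ + 1 = 4 * K ^ j₀ :=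
    ⟨4 * K ^ j₀ - 1, by have := hpow_gt j₀; omega⟩
  have hb1' : b r₀ N ≤ b r₀ (K ^ n) := hanti hr₀Kn hKn_le
  have hb2 : b r₀ (K ^ n) ≤ b r₀ n₂ * b (4 * K ^ j₀) (K ^ n) := by
    have h12 : r₀ ≤ n₂ := by have := hpow_gt j₀; omega
    have h23 : n₂ < K ^ n := by
      have : 4 * K ^ j₀ ≤ K ^ n := four_mul_pow_le_pow hK4le (by omega)
      omega
    have := hsub h12 h23
    rwa [hn₂] at this
  have hb3 : b (4 * K ^ j₀) (K ^ n) ≤ U ^ (d + 1) := hchain d j₀ n le_rfl hd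
  have hbU' : b r₀ N ≤ U ^ (d + 1) := by
    calc b r₀ N ≤ b r₀ (K ^ n) := hb1'
      _ ≤ b r₀ n₂ * b (4 * K ^ j₀) (K ^ n) := hb2
      _ ≤ 1 * U ^ (d + 1) := mul_le_mul (hb1 _ _) hb3 (hb0 _ _) zero_le_one
      _ = U ^ (d + 1) := one_mul _
  have hposN : 0 < b r₀ N := hpos hr₀ (by have := hpow_gt n; omega)
  have hlog_le : Real.log (b r₀ N) ≤ ((d + 1 : ℕ) : ℝ) * (a' * Real.log K) := by
    have := Real.log_le_log hposN hbU'
    rwa [Real.log_pow, hlogU] at this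
  -- `log N`
  have h2N : (1 : ℝ) < N := by
    have : K ≤ K ^ (j₀ + 1 + d₀) := Nat.le_self_pow (by omega) K
    exact_mod_cast (show 2 ≤ N by omega)
  have hlogN_pos : 0 < Real.log (N : ℝ) := Real.log_pos h2N
  have hlogN_lt : Real.log (N : ℝ) < ((n + 1 : ℕ) : ℝ) * Real.log K := by
    have h : (N : ℝ) < (K : ℝ) ^ (n + 1) := by exact_mod_cast hN_lt
    have := Real.log_lt_log (by positivity) h
    rwa [Real.log_pow] at this
  have hT_nonpos : ((d + 1 : ℕ) : ℝ) * (a' * Real.log K) ≤ 0 :=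
    mul_nonpos_of_nonneg_of_nonpos (Nat.cast_nonneg _) (mul_neg_of_neg_of_pos ha'0 hlogKpos).le
  have hnlogK_pos : 0 < ((n + 1 : ℕ) : ℝ) * Real.log K := by positivity
  calc Real.log (b r₀ N) / Real.log N
      ≤ ((d + 1 : ℕ) : ℝ) * (a' * Real.log K) / Real.log N :=
        div_le_div_of_nonneg_right hlog_le hlogN_pos.le
    _ ≤ ((d + 1 : ℕ) : ℝ) * (a' * Real.log K) / (((n + 1 : ℕ) : ℝ) * Real.log K) :=
        div_le_div_of_nonpos_left' hT_nonpos hlogN_pos hlogN_lt.le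
    _ = (a' * d + a') / (1 * d + ((j₀ : ℝ) + 2)) := by
        rw [hd]; push_cast; field_simp; ring
    _ < a := hd₀ d hd₀d

/-- Lower half of the exponent: from the lower scale bound of (A) (`K^{-α-ε} ≤ b(4σ, Kσ)` for
large `K` and then large `σ`), the gapped quasi-multiplicativity (B), monotonicity (D) and
positivity (E), for every `a < -α` eventually `a < log b(r₀, N) / log N` (Smirnov–Werner 2001,
p. 5, lower product bound; Werner 2009, Lecture 5, end of the proof of Thm. 5.2, second display,
and Lecture 6, Cor. 6.2 for the form of (B); sandwich `K^n ≤ N < K^{n+1}`). [cite: SmirnovWernerMRL2001, §3 proof of Thm. 3 (p. 5) and §4] [cite: WernerPCMI2009, Lecture 5, Thm. 5.2 (end of the proof) and Lecture 6, Cor. 6.2] -/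
theorem lower_part (b : ℕ → ℕ → ℝ) (hb0 : ∀ r R, 0 ≤ b r R)
    (hanti : ∀ ⦃r R R' : ℕ⦄, r ≤ R → R ≤ R' → b r R' ≤ b r R)
    {r₁ : ℕ} (hpos : ∀ ⦃r R : ℕ⦄, r₁ ≤ r → r ≤ R → 0 < b r R)
    {c : ℝ} (hc : 0 < c) {n₀ : ℕ}
    (hqm : ∀ ⦃r R S : ℕ⦄, n₀ ≤ r → 16 * r < 4 * R → 4 * R < S → c * (b r R * b (4 * R) S) ≤ b r S)
    {α : ℝ} (hα : 0 < α)
    (hA : ∀ ε : ℝ, 0 < ε → ∀ᶠ K : ℕ in atTop, ∀ᶠ σ : ℕ in atTop, (K : ℝ) ^ (-α - ε) ≤ b (σ * 4) (σ * K))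
    {r₀ : ℕ} (hr₀ : r₁ ≤ r₀) (hr₀' : n₀ ≤ r₀) {a : ℝ} (ha : a < -α) :
    ∀ᶠ N : ℕ in atTop, a < Real.log (b r₀ N) / Real.log N := by
  -- an intermediate exponent `a < a' < -α`
  set a' : ℝ := (a + -α) / 2 with ha'_def
  have ha'1 : a < a' := by rw [ha'_def]; linarith
  have ha'2 : a' < -α := by rw [ha'_def]; linarith
  -- Step 1: the ratio `K` and the scale `σ₀` beyond which `K^{a'} ≤ b(4σ, Kσ)`
  have hA' := hA (-α - a') (by linarith)
  have hε : -α - (-α - a') = a' := by ring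
  simp only [hε] at hA'
  have hlogK : Tendsto (fun K : ℕ => Real.log (K : ℝ)) atTop atTop :=
    Real.tendsto_log_atTop.comp tendsto_natCast_atTop_atTop
  have h2 : Tendsto (fun K : ℕ => a' + Real.log c / Real.log (K : ℝ)) atTop (𝓝 a') := by
    simpa using tendsto_const_nhds.add (tendsto_const_nhds.div_atTop hlogK)
  obtain ⟨K, ⟨hKA, hKc⟩, hK17⟩ :=
    ((hA'.and (h2.eventually_const_lt ha'1)).and (eventually_ge_atTop 17)).exists
  obtain ⟨σ₀, hσ₀⟩ := eventually_atTop.1 hKA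
  have hK5 : 5 ≤ K := by omega
  have hK1 : 1 < K := by omega
  have hKR : (17 : ℝ) ≤ K := by exact_mod_cast hK17
  have hKpos : (0 : ℝ) < K := by linarith
  have hlogKpos : 0 < Real.log (K : ℝ) := Real.log_pos (by linarith)
  -- the per-scale bound `L = K^{a'}`
  set L : ℝ := (K : ℝ) ^ a' with hL_def
  have hL0 : 0 < L := Real.rpow_pos_of_pos hKpos _
  have hlogL : Real.log L = a' * Real.log K := Real.log_rpow hKpos _
  -- Step 2: the first scale `K^{j₀}`
  set j₀ : ℕ := max σ₀ r₀ with hj₀_def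
  have hj₀σ : σ₀ ≤ j₀ := le_max_left _ _
  have hj₀r : r₀ ≤ j₀ := le_max_right _ _
  have hpow_gt : ∀ m : ℕ, m < K ^ m := fun m => Nat.lt_pow_self hK1
  have hn₀K : ∀ m, j₀ ≤ m → n₀ ≤ 4 * K ^ m := fun m hm => by have := hpow_gt m; omega
  have hLm : ∀ m, j₀ ≤ m → L ≤ b (4 * K ^ m) (K ^ (m + 1)) := by
    intro m hm
    have := hσ₀ (K ^ m) (by have := hpow_gt m; omega)
    rwa [mul_comm (K ^ m) 4, ← pow_succ] at this
  have hchain := lower_chain b hb0 hc.le hqm hK17 hn₀K hL0.le hLm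
  -- Step 3: the constant of the first annulus and the affine ratio
  set P : ℝ := c * b r₀ (K ^ j₀) with hP_def
  have hP : 0 < P := mul_pos hc (hpos hr₀ (by have := hpow_gt j₀; omega))
  have h6 : ∀ᶠ d : ℕ in atTop,
      a < ((Real.log c + a' * Real.log K) * d + (Real.log P + a' * Real.log K)) /
        (Real.log K * d + j₀ * Real.log K) := by
    have h := tendsto_affine_div_affine (Real.log c + a' * Real.log K)
      (Real.log P + a' * Real.log K) (Real.log K) (j₀ * Real.log K) hlogKpos.ne'
    have heq : (Real.log c + a' * Real.log K) / Real.log K = a' + Real.log c / Real.log K := by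
      field_simp
      ring
    rw [heq] at h
    exact h.eventually_const_lt hKc
  obtain ⟨d₀, hd₀⟩ := eventually_atTop.1 h6
  -- Step 4: sandwich `K^n ≤ N < K^{n+1}` and conclude
  filter_upwards [eventually_ge_atTop (K ^ (j₀ + 1 + d₀))] with N hN
  have hKpowpos : 0 < K ^ (j₀ + 1 + d₀) := pow_pos (by omega) _
  have hNpos : N ≠ 0 := by omega
  set n := Nat.log K N with hn_def
  have hn_ge : j₀ + 1 + d₀ ≤ n := Nat.le_log_of_pow_le hK1 hN
  have hKn_le : K ^ n ≤ N := Nat.pow_log_le_self K hNpos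
  have hN_lt : N < K ^ (n + 1) := Nat.lt_pow_succ_log_self hK1 N
  obtain ⟨d, hd⟩ : ∃ d, n = j₀ + d := ⟨n - j₀, by omega⟩
  have hd₀d : d₀ ≤ d := by omega
  -- the chain from `4K^{j₀}` to `K^{n+1}`: `d + 1` annuli
  have hb3 : c ^ d * L ^ (d + 1) ≤ b (4 * K ^ j₀) (K ^ (n + 1)) :=
    hchain d j₀ (n + 1) le_rfl (by omega)
  have hr₀N : r₀ ≤ N := by have := hpow_gt n; omega
  have hb1' : b r₀ (K ^ (n + 1)) ≤ b r₀ N := hanti hr₀N hN_lt.le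
  have hb2 : c * (b r₀ (K ^ j₀) * b (4 * K ^ j₀) (K ^ (n + 1))) ≤ b r₀ (K ^ (n + 1)) := by
    refine hqm hr₀' ?_ ?_
    · have := four_mul_lt_pow hK5 j₀
      omega
    · have hKpos' : 0 < K ^ j₀ := pow_pos (by omega) _
      calc 4 * K ^ j₀ < K * K ^ j₀ := Nat.mul_lt_mul_of_pos_right (by omega) hKpos'
        _ = K ^ (j₀ + 1) := by rw [pow_succ, mul_comm]
        _ ≤ K ^ (n + 1) := Nat.pow_le_pow_right (by omega) (by omega)
  have hV : P * (c ^ d * L ^ (d + 1)) ≤ b r₀ N := by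
    calc P * (c ^ d * L ^ (d + 1)) ≤ P * b (4 * K ^ j₀) (K ^ (n + 1)) :=
          mul_le_mul_of_nonneg_left hb3 hP.le
      _ = c * (b r₀ (K ^ j₀) * b (4 * K ^ j₀) (K ^ (n + 1))) := by rw [hP_def]; ring
      _ ≤ b r₀ N := hb2.trans hb1'
  have hcdL : 0 < c ^ d * L ^ (d + 1) := mul_pos (pow_pos hc _) (pow_pos hL0 _)
  have hVpos : 0 < P * (c ^ d * L ^ (d + 1)) := mul_pos hP hcdL
  have hlogV : Real.log (P * (c ^ d * L ^ (d + 1))) =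
      Real.log P + d * Real.log c + ((d + 1 : ℕ) : ℝ) * (a' * Real.log K) := by
    rw [Real.log_mul hP.ne' hcdL.ne', Real.log_mul (pow_pos hc _).ne' (pow_pos hL0 _).ne',
      Real.log_pow, Real.log_pow, hlogL]
    ring
  have hlog_ge : Real.log P + d * Real.log c + ((d + 1 : ℕ) : ℝ) * (a' * Real.log K) ≤
      Real.log (b r₀ N) := by
    rw [← hlogV]
    exact Real.log_le_log hVpos hV
  -- `log N`
  have h2N : (1 : ℝ) < N := by
    have : K ≤ K ^ (j₀ + 1 + d₀) := Nat.le_self_pow (by omega) K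
    exact_mod_cast (show 2 ≤ N by omega)
  have hlogN_pos : 0 < Real.log (N : ℝ) := Real.log_pos h2N
  have hlogN_ge : (n : ℝ) * Real.log K ≤ Real.log (N : ℝ) := by
    have h : (K : ℝ) ^ n ≤ (N : ℝ) := by exact_mod_cast hKn_le
    have := Real.log_le_log (by positivity) h
    rwa [Real.log_pow] at this
  have hnpos : 0 < n := by omega
  have hnlogK_pos : 0 < (n : ℝ) * Real.log K := mul_pos (by exact_mod_cast hnpos) hlogKpos
  set T := Real.log P + d * Real.log c + ((d + 1 : ℕ) : ℝ) * (a' * Real.log K) with hT_def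
  rcases le_or_gt 0 T with hT | hT
  · -- `T ≥ 0`: the ratio is nonnegative, hence above `a < -α < 0`
    have h0 : 0 ≤ Real.log (b r₀ N) / Real.log N := div_nonneg (hT.trans hlog_ge) hlogN_pos.le
    linarith
  · calc a < ((Real.log c + a' * Real.log K) * d + (Real.log P + a' * Real.log K)) /
          (Real.log K * d + j₀ * Real.log K) := hd₀ d hd₀d
      _ = T / ((n : ℝ) * Real.log K) := by
          rw [hT_def, hd]; push_cast; ring
      _ ≤ T / Real.log N := div_le_div_of_nonpos_left' hT.le hnlogK_pos hlogN_ge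
      _ ≤ Real.log (b r₀ N) / Real.log N := div_le_div_of_nonneg_right hlog_ge hlogN_pos.le

/-- **The product-of-scales assembly** (Smirnov–Werner 2001, p. 5, run for Thm. 4; Werner 2009,
Lecture 5, end of the proof of Thm. 5.2, and Lecture 6, Cor. 6.2 for the form of the
quasi-multiplicativity). Let `b(r, R) ∈ [0, 1]` be non-increasing in `R` (D), sub-multiplicative
across adjacent annuli (C), positive from the inner radius `r₁` on (E), quasi-multiplicative in
the gapped form `c · b(r, R) · b(4R, S) ≤ b(r, S)` for `n₀ ≤ r`, `16 r < 4R < S` (B), and suppose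
the annuli of fixed large ratio obey the two-sided scale bounds
`K^{-α-ε} ≤ b(4σ, Kσ) ≤ K^{-α+ε}` for every `ε > 0`, all large `K` and then all large `σ` (A),
with `α > 0`. Then for every `r₀ ≥ max r₁ n₀`, `log b(r₀, N) / log N → -α`, i.e.
`b(r₀, N) = N^{-α + o(1)}`. [cite: SmirnovWernerMRL2001, §3 proof of Thm. 3 (p. 5) and §4] [cite: WernerPCMI2009, Lecture 5, Thm. 5.2 (end of the proof) and Lecture 6, Cor. 6.2] -/
theorem hasDecayExponent_of_scales (b : ℕ → ℕ → ℝ) (hb0 : ∀ r R, 0 ≤ b r R) (hb1 : ∀ r R, b r R ≤ 1)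
    (hanti : ∀ ⦃r R R' : ℕ⦄, r ≤ R → R ≤ R' → b r R' ≤ b r R)
    (hsub : ∀ ⦃n₁ n₂ n₃ : ℕ⦄, n₁ ≤ n₂ → n₂ < n₃ → b n₁ n₃ ≤ b n₁ n₂ * b (n₂ + 1) n₃)
    {r₁ : ℕ} (hpos : ∀ ⦃r R : ℕ⦄, r₁ ≤ r → r ≤ R → 0 < b r R)
    {c : ℝ} (hc : 0 < c) {n₀ : ℕ}
    (hqm : ∀ ⦃r R S : ℕ⦄, n₀ ≤ r → 16 * r < 4 * R → 4 * R < S → c * (b r R * b (4 * R) S) ≤ b r S)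
    {α : ℝ} (hα : 0 < α)
    (hA : ∀ ε : ℝ, 0 < ε → ∀ᶠ K : ℕ in atTop, ∀ᶠ σ : ℕ in atTop,
      (K : ℝ) ^ (-α - ε) ≤ b (σ * 4) (σ * K) ∧ b (σ * 4) (σ * K) ≤ (K : ℝ) ^ (-α + ε))
    {r₀ : ℕ} (hr₀ : r₁ ≤ r₀) (hr₀' : n₀ ≤ r₀) :
    HasDecayExponent (fun N => b r₀ N) α := by
  have hAlow : ∀ ε : ℝ, 0 < ε → ∀ᶠ K : ℕ in atTop, ∀ᶠ σ : ℕ in atTop,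
      (K : ℝ) ^ (-α - ε) ≤ b (σ * 4) (σ * K) :=
    fun ε hε => (hA ε hε).mono fun K hK => hK.mono fun σ hσ => hσ.1
  have hAup : ∀ ε : ℝ, 0 < ε → ∀ᶠ K : ℕ in atTop, ∀ᶠ σ : ℕ in atTop,
      b (σ * 4) (σ * K) ≤ (K : ℝ) ^ (-α + ε) :=
    fun ε hε => (hA ε hε).mono fun K hK => hK.mono fun σ hσ => hσ.2
  unfold HasDecayExponent
  rw [tendsto_order]
  refine ⟨fun a ha => lower_part b hb0 hanti hpos hc hqm hα hAlow hr₀ hr₀' ha, fun a ha => ?_⟩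
  have ha₁ : -α < min a (-α / 2) := lt_min ha (by linarith)
  have ha₁0 : min a (-α / 2) < 0 := lt_of_le_of_lt (min_le_right _ _) (by linarith)
  exact (upper_part b hb0 hb1 hanti hsub hpos hAup hr₀ ha₁ ha₁0).mono fun N hN =>
    hN.trans_le (min_le_left _ _)

/-- From a scaling limit indexed by the ratio — `b(ρ r, ρ R) → b'(R/r)` as `ρ → ∞` with
`log b'(λ) / log λ → -α` as `λ → ∞` (Smirnov–Werner 2001, (16) and (9)) — to the two-sided scale
bounds (A) of the assembly: for every `ε > 0`, for all large `K` and then all large `σ`,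
`K^{-α-ε} ≤ b(4σ, Kσ) ≤ K^{-α+ε}`. Elementary (`log (K/4) / log K → 1`; `b' ≥ 0` as a limit of
nonnegative terms, and `b'(K/4) > 0` for large `K` since `log 0 = 0`). [cite: SmirnovWernerMRL2001, §4 (9) and (16)] -/
theorem scaleBounds_of_ratioLimit (b : ℕ → ℕ → ℝ) (hb0 : ∀ r R, 0 ≤ b r R) (b' : ℝ → ℝ)
    (hlim : ∀ r R : ℕ, 1 ≤ r → r < R →
      Tendsto (fun ρ : ℕ => b (ρ * r) (ρ * R)) atTop (𝓝 (b' ((R : ℝ) / r))))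
    {α : ℝ} (hα : 0 < α) (hexp : Tendsto (fun l : ℝ => Real.log (b' l) / Real.log l) atTop (𝓝 (-α))) :
    ∀ ε : ℝ, 0 < ε → ∀ᶠ K : ℕ in atTop, ∀ᶠ σ : ℕ in atTop,
      (K : ℝ) ^ (-α - ε) ≤ b (σ * 4) (σ * K) ∧ b (σ * 4) (σ * K) ≤ (K : ℝ) ^ (-α + ε) := by
  -- `log b'(K/4) / log K → -α` along `K ∈ ℕ`
  have hcast : Tendsto (fun K : ℕ => (K : ℝ) / 4) atTop atTop :=
    tendsto_natCast_atTop_atTop.atTop_div_const (by norm_num)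
  have h1 : Tendsto (fun K : ℕ => Real.log (b' ((K : ℝ) / 4)) / Real.log ((K : ℝ) / 4)) atTop
      (𝓝 (-α)) := hexp.comp hcast
  have hlogK : Tendsto (fun K : ℕ => Real.log (K : ℝ)) atTop atTop :=
    Real.tendsto_log_atTop.comp tendsto_natCast_atTop_atTop
  have h2 : Tendsto (fun K : ℕ => Real.log ((K : ℝ) / 4) / Real.log (K : ℝ)) atTop (𝓝 1) := by
    have h : Tendsto (fun K : ℕ => 1 - Real.log 4 / Real.log (K : ℝ)) atTop (𝓝 (1 - 0)) :=
      tendsto_const_nhds.sub (tendsto_const_nhds.div_atTop hlogK)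
    rw [sub_zero] at h
    refine h.congr' ?_
    filter_upwards [eventually_ge_atTop 2] with K hK
    have hK' : (2 : ℝ) ≤ K := by exact_mod_cast hK
    have hlog : Real.log (K : ℝ) ≠ 0 := ne_of_gt (Real.log_pos (by linarith))
    rw [Real.log_div (by positivity) (by norm_num)]
    field_simp
  have h3 : Tendsto (fun K : ℕ => Real.log (b' ((K : ℝ) / 4)) / Real.log K) atTop (𝓝 (-α)) := by
    have h := h1.mul h2
    rw [mul_one] at h
    refine h.congr' ?_
    filter_upwards [eventually_ge_atTop 5] with K hK
    have hK' : (5 : ℝ) ≤ K := by exact_mod_cast hK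
    have hlog : Real.log ((K : ℝ) / 4) ≠ 0 := ne_of_gt (Real.log_pos (by linarith))
    have hlog' : Real.log (K : ℝ) ≠ 0 := ne_of_gt (Real.log_pos (by linarith))
    field_simp
  -- it suffices to treat small `ε`
  suffices key : ∀ ε : ℝ, 0 < ε → ε < α → ∀ᶠ K : ℕ in atTop, ∀ᶠ σ : ℕ in atTop,
      (K : ℝ) ^ (-α - ε) ≤ b (σ * 4) (σ * K) ∧ b (σ * 4) (σ * K) ≤ (K : ℝ) ^ (-α + ε) by
    intro ε hε
    have hε' : 0 < min ε (α / 2) := lt_min hε (by linarith)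
    have hε'' : min ε (α / 2) < α := lt_of_le_of_lt (min_le_right _ _) (by linarith)
    filter_upwards [key _ hε' hε'', eventually_ge_atTop 1] with K hK hK1
    have hK1' : (1 : ℝ) ≤ K := by exact_mod_cast hK1
    refine hK.mono fun σ hσ => ⟨le_trans ?_ hσ.1, hσ.2.trans ?_⟩
    · exact Real.rpow_le_rpow_of_exponent_le hK1' (by linarith [min_le_left ε (α / 2)])
    · exact Real.rpow_le_rpow_of_exponent_le hK1' (by linarith [min_le_left ε (α / 2)])
  intro ε hε hεα
  have hup : ∀ᶠ K : ℕ in atTop, Real.log (b' ((K : ℝ) / 4)) / Real.log K < -α + ε / 2 :=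
    h3.eventually_lt_const (by linarith)
  have hlow : ∀ᶠ K : ℕ in atTop, -α - ε / 2 < Real.log (b' ((K : ℝ) / 4)) / Real.log K :=
    h3.eventually_const_lt (by linarith)
  filter_upwards [hup, hlow, eventually_gt_atTop 4] with K hKup hKlow hK4
  have hKR : (5 : ℝ) ≤ K := by exact_mod_cast hK4
  have hKpos : (0 : ℝ) < K := by linarith
  have hlogKpos : 0 < Real.log (K : ℝ) := Real.log_pos (by linarith)
  have hlimK : Tendsto (fun ρ : ℕ => b (ρ * 4) (ρ * K)) atTop (𝓝 (b' ((K : ℝ) / 4))) := by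
    simpa using hlim 4 K (by norm_num) hK4
  -- `b'(K/4) > 0`
  have hg0 : 0 ≤ b' ((K : ℝ) / 4) := ge_of_tendsto' hlimK fun ρ => hb0 _ _
  have hup' : Real.log (b' ((K : ℝ) / 4)) < (-α + ε / 2) * Real.log K := (div_lt_iff₀ hlogKpos).1 hKup
  have hlow' : (-α - ε / 2) * Real.log K < Real.log (b' ((K : ℝ) / 4)) := (lt_div_iff₀ hlogKpos).1 hKlow
  have hneg : Real.log (b' ((K : ℝ) / 4)) < 0 :=
    hup'.trans (mul_neg_of_neg_of_pos (by linarith) hlogKpos)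
  have hgpos : 0 < b' ((K : ℝ) / 4) := by
    rcases hg0.lt_or_eq with h | h
    · exact h
    · exfalso
      rw [← h, Real.log_zero] at hneg
      exact lt_irrefl _ hneg
  -- strict bounds at `ε/2`, then room for the limit
  have hU : b' ((K : ℝ) / 4) < (K : ℝ) ^ (-α + ε / 2) := by
    rw [← Real.log_lt_log_iff hgpos (Real.rpow_pos_of_pos hKpos _), Real.log_rpow hKpos]
    exact hup'
  have hL : (K : ℝ) ^ (-α - ε / 2) < b' ((K : ℝ) / 4) := by
    rw [← Real.log_lt_log_iff (Real.rpow_pos_of_pos hKpos _) hgpos, Real.log_rpow hKpos]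
    exact hlow'
  have hK1 : (1 : ℝ) ≤ K := by linarith
  filter_upwards [hlimK.eventually_lt_const hU, hlimK.eventually_const_lt hL] with σ hσU hσL
  refine ⟨le_trans ?_ hσL.le, hσU.le.trans ?_⟩
  · exact Real.rpow_le_rpow_of_exponent_le hK1 (by linarith)
  · exact Real.rpow_le_rpow_of_exponent_le hK1 (by linarith)

/-- From up-to-constants asymptotics of the annuli of fixed ratio — `c₁ K^{-α} ≤ b(4σ, Kσ) ≤ c₂ K^{-α}`
for all large `K` and then all large `σ` (the form printed by Werner 2009, Lecture 5, proof of
Thm. 5.2: `c₂'' r^{5/4} ≤ lim_n π̂₄(rn, n) ≤ c₁'' r^{5/4}`) — to the two-sided scale bounds (A) of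
the assembly (the constants are absorbed by `K^{±ε}`). Elementary. [cite: WernerPCMI2009, Lecture 5, proof of Thm. 5.2 ("Relation to crossing probabilities")] -/
theorem scaleBounds_of_asympBounds (b : ℕ → ℕ → ℝ) {α c₁ c₂ : ℝ} (hc₁ : 0 < c₁)
    (h : ∀ᶠ K : ℕ in atTop, ∀ᶠ σ : ℕ in atTop,
      c₁ * (K : ℝ) ^ (-α) ≤ b (σ * 4) (σ * K) ∧ b (σ * 4) (σ * K) ≤ c₂ * (K : ℝ) ^ (-α)) :
    ∀ ε : ℝ, 0 < ε → ∀ᶠ K : ℕ in atTop, ∀ᶠ σ : ℕ in atTop,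
      (K : ℝ) ^ (-α - ε) ≤ b (σ * 4) (σ * K) ∧ b (σ * 4) (σ * K) ≤ (K : ℝ) ^ (-α + ε) := by
  intro ε hε
  -- `K^ε → ∞`: eventually `c₂ ≤ K^ε` and `c₁⁻¹ ≤ K^ε`
  have hKε : Tendsto (fun K : ℕ => (K : ℝ) ^ ε) atTop atTop :=
    (tendsto_rpow_atTop hε).comp tendsto_natCast_atTop_atTop
  filter_upwards [h, hKε.eventually_ge_atTop c₂, hKε.eventually_ge_atTop c₁⁻¹,
    eventually_ge_atTop 1] with K hK hK₂ hK₁ hK1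
  have hK1' : (1 : ℝ) ≤ K := by exact_mod_cast hK1
  have hKpos : (0 : ℝ) < K := by linarith
  have hpowpos : 0 < (K : ℝ) ^ (-α) := Real.rpow_pos_of_pos hKpos _
  refine hK.mono fun σ hσ => ⟨le_trans ?_ hσ.1, hσ.2.trans ?_⟩
  · -- `K^{-α-ε} = K^{-α} / K^ε ≤ c₁ K^{-α}`
    rw [show -α - ε = -α + -ε by ring, Real.rpow_add hKpos, Real.rpow_neg hKpos.le ε]
    rw [mul_comm]
    refine mul_le_mul_of_nonneg_right ?_ hpowpos.le
    rw [inv_le_comm₀ (Real.rpow_pos_of_pos hKpos _) hc₁]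
    exact hK₁
  · calc c₂ * (K : ℝ) ^ (-α) ≤ (K : ℝ) ^ ε * (K : ℝ) ^ (-α) := mul_le_mul_of_nonneg_right hK₂ hpowpos.le
      _ = (K : ℝ) ^ (-α + ε) := by rw [Real.rpow_add hKpos, mul_comm]

end ArmExponentAssembly

/-! ### The four-arm exponent from Smirnov–Werner's two observations -/

/-- **Quasi-multiplicativity of the critical four-arm probability** in Werner's gapped form, read
off from the named fact `Werner2009_fourArm_quasiMult` at `t = 1/2` (where the restriction
`S ≤ L(t)` is void): there are a threshold `n₀` and `c > 0` with
`c · π₄(r, R) · π₄(4R, S) ≤ π₄(r, S)` for `n₀ ≤ r`, `16 r < 4R < S`. (Werner 2009, Lecture 6,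
Cor. 6.2, and Lecture 5, Lemmas 5.1–5.2 at `p = 1/2`; Smirnov–Werner 2001, (10), right half.) [cite: WernerPCMI2009, Lecture 6, Cor. 6.2] [cite: SmirnovWernerMRL2001, §4 (10)] -/
theorem critFourArmProb_quasiMult_of_fact (hB : Werner2009_fourArm_quasiMult) :
    ∃ n₀ : ℕ, ∃ c > (0 : ℝ), ∀ ⦃r R S : ℕ⦄, n₀ ≤ r → 16 * r < 4 * R → 4 * R < S →
      c * (critFourArmProb r R * critFourArmProb (4 * R) S) ≤ critFourArmProb r S := by
  obtain ⟨ε₁, hε₁, h⟩ := hB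
  obtain ⟨r₁, δ, hδ, c, hc, hq⟩ := h (half_pos hε₁) (half_lt_self hε₁)
  refine ⟨r₁, c, hc, fun r R S hr hrR hRS => ?_⟩
  have := hq half (by simp) (by simp; linarith) r R S hr hrR hRS (fun hlt => absurd hlt (by simp))
  simpa only [fourArmProbAt_half] using this

/-- **Assembly of the four-arm exponent from two-sided scale bounds** (Smirnov–Werner 2001, Thm. 4
for `j = 4`, by the argument printed on p. 5; Werner 2009, Lecture 5, Thm. 5.2, "End of the
proof"). IF for every `ε > 0`, for all large ratios `K` and then all large scales `σ`, the critical
four-arm probability of the hexagonal annulus `Λ_{Kσ} ∖ Λ_{4σ}` satisfies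
`K^{-5/4-ε} ≤ π₄(4σ, Kσ) ≤ K^{-5/4+ε}` — hypothesis `hA`, the deep input: Smirnov's theorem
(convergence of the exploration processes to `SLE₆`) and the `SLE₆` exponent `5/4` of
Lawler–Schramm–Werner (SW (9), (12)–(16); Werner, Lecture 5, §3: `lim_n π̂₄(rn, n) ≍ r^{5/4}`) —
and π₄ is quasi-multiplicative (`Werner2009_fourArm_quasiMult`; SW (10)), THEN `fourArm_exponent`
holds, with threshold `r₁ = max 1 n₀` (`n₀` the threshold of the quasi-multiplicativity);
sub-multiplicativity, monotonicity and positivity of `π₄` are the proved inputs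
`polyArmProb_submult`, `polyArmProb_anti_holds`, `critFourArmProb_pos`. [cite: SmirnovWernerMRL2001, Thm. 4 (j = 4) and p. 5] [cite: WernerPCMI2009, Lecture 5, Thm. 5.2] -/
theorem fourArm_exponent_of_scaleBounds
    (hA : ∀ ε : ℝ, 0 < ε → ∀ᶠ K : ℕ in atTop, ∀ᶠ σ : ℕ in atTop,
      (K : ℝ) ^ (-(5 / 4 : ℝ) - ε) ≤ critFourArmProb (σ * 4) (σ * K) ∧
        critFourArmProb (σ * 4) (σ * K) ≤ (K : ℝ) ^ (-(5 / 4 : ℝ) + ε))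
    (hB : Werner2009_fourArm_quasiMult) : fourArm_exponent := by
  obtain ⟨n₀, c, hc, hqm⟩ := critFourArmProb_quasiMult_of_fact hB
  refine ⟨max 1 n₀, fun r₀ hr₀ => ?_⟩
  have hr₀1 : 1 ≤ r₀ := le_trans (le_max_left _ _) hr₀
  have hr₀n : n₀ ≤ r₀ := le_trans (le_max_right _ _) hr₀
  exact ArmExponentAssembly.hasDecayExponent_of_scales (fun r R => critFourArmProb r R)
    (fun r R => polyArmProb_nonneg _ r R) (fun r R => polyArmProb_le_one _ r R)
    (fun r R R' hr hR => polyArmProb_anti_holds _ hr hR)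
    (fun n₁ n₂ n₃ h₁₂ h₂₃ => polyArmProb_submult _ h₁₂ h₂₃)
    (fun r R hr hR => critFourArmProb_pos hr hR) hc hqm (by norm_num) hA hr₀1 hr₀n

/-- **Assembly of the four-arm exponent from the scaling limit** (Smirnov–Werner 2001, Thm. 4 for
`j = 4`, from the two observations of §4). IF the critical four-arm probabilities of the
hexagonal annuli `Λ_{ρR} ∖ Λ_{ρr}` have a scaling limit `b'(R/r)` as `ρ → ∞` (SW (16), Smirnov's
theorem) with `b'(λ) = λ^{-5/4 + o(1)}` as `λ → ∞` (SW (9) with (15): convergence of the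
exploration process to `SLE₆` and the `SLE₆` exponents of Lawler–Schramm–Werner,
`(4² - 1)/12 = 5/4`) — hypothesis `hA`, spelled out in the shape of the two-arm named fact
`SmirnovWerner2001_twoArm_scalingLimit` — and π₄ is quasi-multiplicative
(`Werner2009_fourArm_quasiMult`, SW (10)), THEN `fourArm_exponent` holds. [cite: SmirnovWernerMRL2001, Thm. 4 (j = 4), §4 (9), (10), (16) and p. 5] -/
theorem fourArm_exponent_of_scalingLimit
    (hA : ∃ b' : ℝ → ℝ,
      (∀ r R : ℕ, 1 ≤ r → r < R →
        Tendsto (fun ρ : ℕ => critFourArmProb (ρ * r) (ρ * R)) atTop (𝓝 (b' ((R : ℝ) / r)))) ∧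
      Tendsto (fun l : ℝ => Real.log (b' l) / Real.log l) atTop (𝓝 (-(5 / 4))))
    (hB : Werner2009_fourArm_quasiMult) : fourArm_exponent := by
  obtain ⟨b', hlim, hexp⟩ := hA
  exact fourArm_exponent_of_scaleBounds
    (ArmExponentAssembly.scaleBounds_of_ratioLimit (fun r R => critFourArmProb r R)
      (fun r R => polyArmProb_nonneg _ r R) b' hlim (by norm_num) hexp) hB

/-- **Assembly of the four-arm exponent from up-to-constants asymptotics** (Werner 2009, Lecture 5,
Thm. 5.2: the form in which the `SLE₆` input is printed there, "Relation to crossing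
probabilities": `c₂'' r^{5/4} ≤ lim_n π̂₄(rn, n) ≤ c₁'' r^{5/4}` for small `r`, with
`π̂₄ ≤ π₄ ≤ 2 π̂₄`). IF `c₁ K^{-5/4} ≤ π₄(4σ, Kσ) ≤ c₂ K^{-5/4}` for all large `K` and then all large
`σ` — hypothesis `hA`, the deep input — and π₄ is quasi-multiplicative
(`Werner2009_fourArm_quasiMult`, Lecture 6, Cor. 6.2), THEN `fourArm_exponent` holds. [cite: WernerPCMI2009, Lecture 5, Thm. 5.2] -/
theorem fourArm_exponent_of_asympBounds {c₁ c₂ : ℝ} (hc₁ : 0 < c₁)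
    (hA : ∀ᶠ K : ℕ in atTop, ∀ᶠ σ : ℕ in atTop,
      c₁ * (K : ℝ) ^ (-(5 / 4 : ℝ)) ≤ critFourArmProb (σ * 4) (σ * K) ∧
        critFourArmProb (σ * 4) (σ * K) ≤ c₂ * (K : ℝ) ^ (-(5 / 4 : ℝ)))
    (hB : Werner2009_fourArm_quasiMult) : fourArm_exponent :=
  fourArm_exponent_of_scaleBounds
    (ArmExponentAssembly.scaleBounds_of_asympBounds (fun r R => critFourArmProb r R) hc₁ hA) hB

end Literature.Probability.Percolation
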